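import Summits.BirchSwinnertonDyer.Rank1Residual.Additive.CyclotomicTowerSelmerDualRestriction
import Summits.BirchSwinnertonDyer.Rank1Residual.Additive.ChiBranchLowerInput
import Summits.BirchSwinnertonDyer.Rank1Residual.Additive.ChiBranchLowerInputOdd
import Literature.NumberTheory.EllipticCurves.PAdicBSD
import HarnessLib

/-!
# Route `AdditiveBranchIMC` (rung K1), crux `GordTwoRankZeroOffCaseOne` (item 19357), lane k1-c2x: the
# ONE uniform input of the twist-field road, NAMED — the main-conjecture containment `char ⊆ (𝓛)` for
# the GOOD ORDINARY twist `V = E♭` over the cyclotomic `ℤ_p`-extension of the twist field `K = ℚ(√p*)`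
# (definitions; nothing asserted)

Cell `bsd-addord`, seat `bsd-addord-k1-c2x` (second prover lane on item 19357; director-bsd 2026-08-27:
«uniform IMC-branch divisibility via Skinner–Urban over the quadratic twist field with explicit control
at the additive prime»). HONEST FRAMING: two `def`s = typed INPUTS and their unfolding lemmas; no named
fact is minted, nothing is asserted, no universal closure is claimed, nothing is booked; BSD is not
proved by any of this. A prover does not file statement items (D-0014): the planner decides whether the
universal closure of these predicates becomes an item.

## What and why

At an odd additive prime `p` of type (G-ord) with semistability index `2` the curve `E` is the twist
`V ⊗ χ_K` of a curve `V = E♭` GOOD ORDINARY at `p` by the quadratic character of `K = ℚ(√p*)`,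
`p* = (−1)^{(p−1)/2} p`; over `K` the two curves become isomorphic and `V/K` has good ordinary reduction
at the (ramified) prime above `p`. The route's Λ-adic inputs `ChiBranchLowerDivisibility[Odd]At W p`
(items 19497/19498; k1-c2: equivalent to the crux on the tower-surjective rank-`0` rows) are the
containment `char_Λ X(E/ℚ_∞) ⊆ (ϖ·L_p(f, α, ω^{(p−1)/2}, T))` on the `ω^{(p−1)/2}`-BRANCH of `V` — in
print for no weight-two form (Skinner–Urban 2014 Thm. 3.6.4: trivial tame branch only). The road of
this lane restates the SAME containment one level up, over the twist field: by Artin formalism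
`L(V/K, ψ, 1) = L(f, ψ, 1)·L(f, χ_K ψ, 1)` for every finite-order character `ψ` of
`Γ = Gal(K_∞^{cyc}/K) = Gal(ℚ_∞/ℚ)`, and `χ_K` is, as a Dirichlet character, the Legendre symbol
`(·/p) = ω^{(p−1)/2}`; so the cyclotomic `p`-adic `L`-function of `V` over `K` is — in the tree's two
typed normalisations, `Ω⁺_f` for the trivial branch (`padicLFunction f α`, as in `kato_divisibility` /
`skinner_urban_main_conjecture`) and Néron for the `χ`-branch (`ϖ·padicLFunction[Minus]Branch f α (p/2)`,
as in `ChiBranchLowerDivisibility[Odd]At`) — the PRODUCT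
`𝓛_K(V, T) := L_p(f, α, T) · ϖ·L_p^{[−]}(f, α, ω^{(p−1)/2}, T)`, while on the algebraic side the classical
Iwasawa module `X(V/K_∞^{cyc}) = X(V/K·ℚ_∞)` (the tree's `Γ_ℚ`-internal `TowerSelmerDualData V κ K γ`,
cell `bsd-potss`) satisfies `char_Λ X(V/K·ℚ_∞) = char_Λ X(V/ℚ_∞) · char_Λ X(E/ℚ_∞)` — PROVED in this
lane (`AdditiveBranchIMCTwistFieldCharIdeal.charIdeal_towerDual_eq_mul`, p530383/p529345). This file
NAMES the K-level containment:

* `TwistFieldLowerDivisibilityEvenAt V p` (`p ≡ 1 (mod 4)`, `K = ℚ(√p)` real quadratic, plus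
  symbols): for every quadratic field `K = ℚ(θ)`, `θ² = p`, cyclotomic `κ` with a topological generator
  `γ ∈ Gal(ℚ̄/K)` matching the cyclotomic variable, newform `f` of `V`, tower datum `D` of
  `Sel_{p^∞}(V/K·ℚ_∞)` and `ϖ·Ω_V = Ω⁺_f`: EVERY `g ∈ char_Λ X(V/K·ℚ_∞)` is, in `ℚ_p⟦T⟧`, a `Λ`-multiple
  of `L_p(f, α, T) · ϖ·L_p(f, α, ω^{(p−1)/2}, T)`;
* `TwistFieldLowerDivisibilityOddAt V p` (`p ≡ 3 (mod 4)`, `p = 3` included, `K = ℚ(√−p)` imaginary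
  quadratic, minus symbols, `ϖ⁻·|Ω⁻(V)| = Ω⁻_f`): the odd twin.

The sequel `AdditiveBranchIMCTwistFieldReduction` proves: (⇐) `ChiBranchLowerDivisibility[Odd]At W p`
together with the integral containment for `V/ℚ_∞` implies it; (⇒) it implies
`ChiBranchLowerDivisibility[Odd]At W p` given Kato's integral divisibility for `V/ℚ_∞` (tower-surjective
`ρ_{V,p}`) and `L_p(f, α, T) ≠ 0` (Rohrlich) — so the twist-field road and the branch road ask for the
SAME missing theorem, stated over `K` resp. over `ℚ(μ_p)`.

## Status in print (why this is an INPUT, not a fact)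

For `V/K` good ordinary at the prime above `p` with `p ∣ d_K`: Wan 2015 (Hilbert modular forms, `K`
real) assumes `p` unramified in the totally real field (tree: `Wan2015_theorem7_ellipticCurve` carries
`¬ p ∣ discr F`); Skinner–Urban 2014 §3 / Wan's `U(3,1)` main conjectures over an imaginary quadratic
field assume `p` split; Burungale–Castella–Skinner 2025 §5 choose auxiliary fields with `p` split or
unramified; Burungale–Skinner–Tian–Wan arXiv:2409.01350 Thm. 9.21 (c) is announced for `p ∤ 2N_g`. No
printed main-conjecture lower bound covers a quadratic field in which `p` ramifies (cell census, k1-c2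
gens 0–7, k1-c4 `MultTwistBaseChangeLowerAt`, this lane's NOTES). Normalisation caveat: a K-level source
states `char ⊆ (L_p(V/K))` with ITS period `Ω(V/K)`; matching the product above needs the base-change
period relation (Shimura) and Pal's twist-period theorem (`√p·Ω(E)/Ω(V)`, Pal 2012 Thm. 3.2) — part of
what such a source must supply, not asserted here.

References: Skinner–Urban, Invent. Math. 195 (2014) Thm. 3.6.4, §3.6 [SkinnerUrban2014]; X. Wan, Algebra
& Number Theory 9 (2015) §1.1 [Wan2015HilbertIMC]; Mazur–Tate–Teitelbaum, Invent. Math. 84 (1986)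
§I.13–I.14 [MazurTateTeitelbaum1986Invent]; R. Greenberg, LNM 1716 (1999) §1, §5 [GreenbergLNM1716];
K. Kato, Astérisque 295 (2004) Thm. 17.4 [Kato2004Asterisque]; V. Pal, Proc. AMS 140 (2012) Thm. 3.2 [Pal2012].
-/

set_option autoImplicit false
set_option linter.dupNamespace false

noncomputable section

open scoped Classical MatrixGroups ModularForm

open CongruenceSubgroup WeierstrassCurve Literature.NumberTheory.EllipticCurves
  Literature.NumberTheory.EllipticCurves.ModularForms
  Literature.NumberTheory.EllipticCurves.Rank1Residual
  Literature.NumberTheory.GaloisRepresentations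

namespace Summit.BirchSwinnertonDyer.BirchSwinnertonDyer.Theorems.AdditiveBranchIMCTwistField

open Summit.BirchSwinnertonDyer.Rank1Residual.Additive (TowerSelmerDualData)

/-- **The main-conjecture containment `char ⊆ (𝓛)` for the good ordinary twist `V` over the cyclotomic
`ℤ_p`-extension of the REAL quadratic twist field `K = ℚ(√p)`, TYPED** (`p ≡ 1 (mod 4)`, product
normalisation). For `V/ℚ` globally minimal and GOOD ORDINARY at `p`: for every quadratic field
`K = ℚ(θ)`, `θ² = p` (so `Gal(ℚ̄/K)` is normal of index `2`), every cyclotomic `ℤ_p`-extension datum `κ`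
with a topological generator `γ ∈ Gal(ℚ̄/K)` matching the cyclotomic variable, the newform `f` of `V`,
every Pontryagin-dual datum `D` of the classical `Sel_{p^∞}(V/K·ℚ_∞)` (`TowerSelmerDualData V κ K γ`,
the Iwasawa module `X(V/K_∞^{cyc})` of `V` over the twist field, `Γ_ℚ`-internally) and every `ϖ ∈ ℚ`
with `ϖ·Ω_V = Ω⁺_f`: EVERY `g ∈ char_Λ X(V/K·ℚ_∞)` is, in `ℚ_p⟦T⟧`, a `Λ`-multiple of
`L_p(f, α, T) · (ϖ · L_p(f, α, ω^{(p−1)/2}, T))`, `α = unitRoot V p` — i.e.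
`char_Λ X(V/K_∞^{cyc}) ⊆ (𝓛_K(V))` with `𝓛_K(V)` the cyclotomic `p`-adic `L`-function of `V/K` written,
by Artin formalism (`L(V/K,ψ,1) = L(f,ψ,1)·L(f,χ_Kψ,1)`, `χ_K = (·/p) = ω^{(p−1)/2}`), as the product
of the tree's two typed currencies (trivial branch `Ω⁺_f`-normalised as in `kato_divisibility`,
`χ`-branch Néron-normalised as in `ChiBranchLowerDivisibilityAt`). The Skinner–Urban / Wan direction for
an elliptic curve over a real quadratic field at a good ordinary prime RAMIFIED in the field: NOT in
print (Wan 2015: `p` unramified). A predicate on `(V, p)`; its universal closure is NOT asserted.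
[cite: Wan2015HilbertIMC, §1.1 (shape only; p unramified there; nothing asserted)]
[cite: SkinnerUrban2014, Thm. 3.6.4 (p. 43) (shape only; nothing asserted)]
[cite: MazurTateTeitelbaum1986Invent, §I.13–I.14 (the branch series)]
[cite: GreenbergLNM1716, §1 pp. 60–61 (Selmer groups and main conjecture over a number field F; shape only)] -/
@[conjecture] def TwistFieldLowerDivisibilityEvenAt (V : WeierstrassCurve ℚ) [V.IsElliptic] [V.IsGloballyMinimal]
    (p : ℕ) [Fact p.Prime] : Prop :=
  ∀ (K : Type) [Field K] [NumberField K] [(galRange (K := ℚ) K).Normal] (θ : K)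
    {κ : ZpExtension ℚ p} {γ : Field.absoluteGaloisGroup ℚ} {N : ℕ} [NeZero N]
    {f : CuspForm (Gamma0 N) 2},
    p % 4 = 1 → Module.finrank ℚ K = 2 → θ ∉ Set.range (algebraMap ℚ K) →
    θ ^ 2 = algebraMap ℚ K (p : ℚ) → GoodOrd V p →
    κ.IsCyclotomic → κ.IsTopGenerator γ → IsCyclotomicVariable p γ → γ ∈ galRange (K := ℚ) K →
    IsNewformOf V f →
    ∀ (D : TowerSelmerDualData V κ K γ) (ϖ : ℚ), (ϖ : ℝ) * V.realPeriodRat = plusPeriod f →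
      ∀ g ∈ Literature.NumberTheory.EllipticCurves.Module.charIdeal (IwasawaAlgebra p) D.X,
        ∃ h : IwasawaAlgebra p,
          iwasawaToPowerSeries p g =
            iwasawaToPowerSeries p h *
              (padicLFunction f (unitRoot V p : ℚ_[p]) *
                (PowerSeries.C ((ϖ : ℚ) : ℚ_[p]) *
                  padicLFunctionBranch f (unitRoot V p : ℚ_[p]) (p / 2)))

/-- **The main-conjecture containment `char ⊆ (𝓛)` for the good ordinary twist `V` over the cyclotomic
`ℤ_p`-extension of the IMAGINARY quadratic twist field `K = ℚ(√−p)`, TYPED** (`p ≡ 3 (mod 4)`, `p = 3`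
included; product normalisation, minus symbols). Odd twin of `TwistFieldLowerDivisibilityEvenAt`:
`θ² = −p`, `ϖ⁻·|Ω⁻(V)| = Ω⁻_f` (`V.imaginaryPeriodRat`, `minusPeriod f`), and the `χ`-branch factor is
`ϖ⁻·L_p⁻(f, α, ω^{(p−1)/2}, T)` (`padicLFunctionMinusBranch`, as in `ChiBranchLowerDivisibilityOddAt`).
The Skinner–Urban direction for an elliptic curve over an imaginary quadratic field at a good ordinary
prime RAMIFIED in the field (cyclotomic line): NOT in print (Skinner–Urban 2014 §3 / Wan: `p` split).
A predicate on `(V, p)`; its universal closure is NOT asserted.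
[cite: SkinnerUrban2014, Thm. 3.6.4 and §3.6 (pp. 42–43) (shape only; p split there; nothing asserted)]
[cite: MazurTateTeitelbaum1986Invent, §I.13–I.14 (the minus branch series)]
[cite: GreenbergLNM1716, §1 pp. 60–61 (Selmer groups and main conjecture over a number field F; shape only)] -/
@[conjecture] def TwistFieldLowerDivisibilityOddAt (V : WeierstrassCurve ℚ) [V.IsElliptic] [V.IsGloballyMinimal]
    (p : ℕ) [Fact p.Prime] : Prop :=
  ∀ (K : Type) [Field K] [NumberField K] [(galRange (K := ℚ) K).Normal] (θ : K)
    {κ : ZpExtension ℚ p} {γ : Field.absoluteGaloisGroup ℚ} {N : ℕ} [NeZero N]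
    {f : CuspForm (Gamma0 N) 2},
    p % 4 = 3 → Module.finrank ℚ K = 2 → θ ∉ Set.range (algebraMap ℚ K) →
    θ ^ 2 = algebraMap ℚ K (-(p : ℚ)) → GoodOrd V p →
    κ.IsCyclotomic → κ.IsTopGenerator γ → IsCyclotomicVariable p γ → γ ∈ galRange (K := ℚ) K →
    IsNewformOf V f →
    ∀ (D : TowerSelmerDualData V κ K γ) (ϖ : ℚ), (ϖ : ℝ) * V.imaginaryPeriodRat = minusPeriod f →
      ∀ g ∈ Literature.NumberTheory.EllipticCurves.Module.charIdeal (IwasawaAlgebra p) D.X,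
        ∃ h : IwasawaAlgebra p,
          iwasawaToPowerSeries p g =
            iwasawaToPowerSeries p h *
              (padicLFunction f (unitRoot V p : ℚ_[p]) *
                (PowerSeries.C ((ϖ : ℚ) : ℚ_[p]) *
                  padicLFunctionMinusBranch f (unitRoot V p : ℚ_[p]) (p / 2)))

/-- Unfolding lemma for `TwistFieldLowerDivisibilityEvenAt` (to apply the predicate as a function). -/
theorem twistFieldLowerDivisibilityEvenAt_iff (V : WeierstrassCurve ℚ) [V.IsElliptic]
    [V.IsGloballyMinimal] (p : ℕ) [Fact p.Prime] :
    TwistFieldLowerDivisibilityEvenAt V p ↔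
      ∀ (K : Type) [Field K] [NumberField K] [(galRange (K := ℚ) K).Normal] (θ : K)
        {κ : ZpExtension ℚ p} {γ : Field.absoluteGaloisGroup ℚ} {N : ℕ} [NeZero N]
        {f : CuspForm (Gamma0 N) 2},
        p % 4 = 1 → Module.finrank ℚ K = 2 → θ ∉ Set.range (algebraMap ℚ K) →
        θ ^ 2 = algebraMap ℚ K (p : ℚ) → GoodOrd V p →
        κ.IsCyclotomic → κ.IsTopGenerator γ → IsCyclotomicVariable p γ → γ ∈ galRange (K := ℚ) K →
        IsNewformOf V f →
        ∀ (D : TowerSelmerDualData V κ K γ) (ϖ : ℚ), (ϖ : ℝ) * V.realPeriodRat = plusPeriod f →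
          ∀ g ∈ Literature.NumberTheory.EllipticCurves.Module.charIdeal (IwasawaAlgebra p) D.X,
            ∃ h : IwasawaAlgebra p,
              iwasawaToPowerSeries p g =
                iwasawaToPowerSeries p h *
                  (padicLFunction f (unitRoot V p : ℚ_[p]) *
                    (PowerSeries.C ((ϖ : ℚ) : ℚ_[p]) *
                      padicLFunctionBranch f (unitRoot V p : ℚ_[p]) (p / 2))) :=
  Iff.rfl

/-- Unfolding lemma for `TwistFieldLowerDivisibilityOddAt` (to apply the predicate as a function). -/
theorem twistFieldLowerDivisibilityOddAt_iff (V : WeierstrassCurve ℚ) [V.IsElliptic]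
    [V.IsGloballyMinimal] (p : ℕ) [Fact p.Prime] :
    TwistFieldLowerDivisibilityOddAt V p ↔
      ∀ (K : Type) [Field K] [NumberField K] [(galRange (K := ℚ) K).Normal] (θ : K)
        {κ : ZpExtension ℚ p} {γ : Field.absoluteGaloisGroup ℚ} {N : ℕ} [NeZero N]
        {f : CuspForm (Gamma0 N) 2},
        p % 4 = 3 → Module.finrank ℚ K = 2 → θ ∉ Set.range (algebraMap ℚ K) →
        θ ^ 2 = algebraMap ℚ K (-(p : ℚ)) → GoodOrd V p →
        κ.IsCyclotomic → κ.IsTopGenerator γ → IsCyclotomicVariable p γ → γ ∈ galRange (K := ℚ) K →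
        IsNewformOf V f →
        ∀ (D : TowerSelmerDualData V κ K γ) (ϖ : ℚ), (ϖ : ℝ) * V.imaginaryPeriodRat = minusPeriod f →
          ∀ g ∈ Literature.NumberTheory.EllipticCurves.Module.charIdeal (IwasawaAlgebra p) D.X,
            ∃ h : IwasawaAlgebra p,
              iwasawaToPowerSeries p g =
                iwasawaToPowerSeries p h *
                  (padicLFunction f (unitRoot V p : ℚ_[p]) *
                    (PowerSeries.C ((ϖ : ℚ) : ℚ_[p]) *
                      padicLFunctionMinusBranch f (unitRoot V p : ℚ_[p]) (p / 2))) :=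
  Iff.rfl

/-! ## The DESCENDED (base-change, Burungale–Castella–Skinner (5.3)-shape) form of the K-level input,
## RATIONAL, for the pair `{V, W = V^{(p*)}}` — predicates on the additive pair `(W, p)` (gen 2 of the lane)

The two `@[conjecture]` defs above state the K-level containment INTEGRALLY and over the tower datum
`X(V/K·ℚ_∞)`. The cell's (M)-twin (`AdditiveBranchIMCMultLower.MultTwistBaseChangeLowerAt`, k1-c4) states
its input in the DESCENDED product shape of Burungale–Castella–Skinner 2025 §5 (5.3) — no field `K`, no
tower datum, a `p`-power slack on both sides: `∃ m n G`, `ι G = p^n · 𝓛` and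
`p^m · char X(V/ℚ_∞) · char X(W/ℚ_∞) ⊆ (G)`. The two predicates below are the SAME shape on cell
(G-ord, `e = 2`): `𝓛 = L_p(f, α, T) · ϖ · L_p^{[−]}(f, α, ω^{(p−1)/2}, T)` (`α = unitRoot V p`, the product
of the tree's two typed currencies, as above), stated at the additive pair `(W, p)` for every good ordinary
twist model `V` (`C • V^{(±p)} = W`), every cyclotomic datum and every pair of TORSION dual data
`DV = X(V/ℚ_∞)`, `D = X(W/ℚ_∞)` (torsion is a guard, not a claim: Kato 2004 Thm. 17.4 (1) for `V`; for `W`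
the reading [C]). By `charIdeal_towerDual_eq_mul` (this lane) they are implied by the integral K-level
predicates (sequel `…TwistFieldBaseChange`, given boundedness of `𝓛`), and — the point of the descended
form — they feed the branch containment `ChiBranchLowerDivisibility[Odd]At W p` through Kato's RATIONAL
divisibility for `V` (Thm. 17.4 (2), NO image hypothesis) plus ONE unit coefficient of the branch
`p`-adic `L`-function at the pair (a finite certificate), instead of Kato's integral clause (3) (tower-
surjective image). NOT IN PRINT at any pair (Skinner–Urban 2014 Cor. 3.6.3 is this shape with `χ_K`
UNRAMIFIED at `p`; Wan 2015: `p` unramified; BCS 2025 Lemma 5.2.3: auxiliary fields with `p` split /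
inert). Predicates; their universal closures are NOT asserted; nothing is booked. -/

/-- **(BC-Gord, even), named: the base-change product bound for the pair `{V, W = V^{(p)}}`**,
`p ≡ 1 (mod 4)` entering only through the consumer (`K = ℚ(√p)` real; plus symbols, `ϖ·Ω_V = Ω⁺_f`):
for every globally minimal GOOD ORDINARY twist model `V` of `W` (`C • V^{(p)} = W`), newform `f` of
`V`, cyclotomic datum `(κ, γ)` matching the cyclotomic variable, TORSION dual data `DV` of
`Sel_{p^∞}(V/ℚ_∞)` and `D` of `Sel_{p^∞}(W/ℚ_∞)`, and `ϖ` with `ϖ·Ω_V = Ω⁺_f`: `∃ m n G`,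
`ι G = p^n · L_p(f, α, T) · ϖ·L_p(f, α, ω^{(p−1)/2}, T)` and `p^m · x · y ∈ (G)` for all
`x ∈ char_Λ X(V/ℚ_∞)`, `y ∈ char_Λ X(W/ℚ_∞)` — Burungale–Castella–Skinner (5.3) shape; the descended,
rational form of `TwistFieldLowerDivisibilityEvenAt V p` (`char X(V/K·ℚ_∞) = char X(V/ℚ_∞)·char X(W/ℚ_∞)`).
A predicate on `(W, p)`; OPEN — NOT in print at any additive pair; its universal closure is NOT asserted.
[cite: BurungaleCastellaSkinner2025, §5 (5.3) and Lemma 5.2.3 (shape only; p split/inert there; nothing asserted)]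
[cite: SkinnerUrban2014, Cor. 3.6.3 (p. 42) (shape only; χ_K unramified at p there; nothing asserted)]
[cite: MazurTateTeitelbaum1986Invent, §I.13–I.14 (the branch series)] -/
@[conjecture] def GordTwistBaseChangeLowerEvenAt (W : WeierstrassCurve ℚ) (p : ℕ) [Fact p.Prime] : Prop :=
  ∀ (V : WeierstrassCurve ℚ) [V.IsElliptic] [V.IsGloballyMinimal] (C : VariableChange ℚ),
    GoodOrd V p → C • V.quadraticTwist (p : ℚ) = W →
    ∀ {N : ℕ} [NeZero N] (f : CuspForm (Gamma0 N) 2), IsNewformOf V f →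
    ∀ (κ : ZpExtension ℚ p) (γ : Field.absoluteGaloisGroup ℚ),
      κ.IsCyclotomic → κ.IsTopGenerator γ → IsCyclotomicVariable p γ →
    ∀ (DV : V.SelmerDualData κ γ) (D : W.SelmerDualData κ γ) (ϖ : ℚ),
      DV.IsTorsion → D.IsTorsion → (ϖ : ℝ) * V.realPeriodRat = plusPeriod f →
      ∃ (m n : ℕ) (G : IwasawaAlgebra p),
        iwasawaToPowerSeries p G =
          PowerSeries.C ((p : ℚ_[p]) ^ n) *
            (padicLFunction f (unitRoot V p : ℚ_[p]) *
              (PowerSeries.C ((ϖ : ℚ) : ℚ_[p]) *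
                padicLFunctionBranch f (unitRoot V p : ℚ_[p]) (p / 2))) ∧
        ∀ x ∈ DV.charIdeal, ∀ y ∈ D.charIdeal,
          PowerSeries.C ((p : ℤ_[p]) ^ m) * (x * y) ∈ Ideal.span {G}

/-- **(BC-Gord, odd), named: the base-change product bound for the pair `{V, W = V^{(−p)}}`**
(`p ≡ 3 (mod 4)`, `p = 3` included, through the consumer; `K = ℚ(√−p)` imaginary; minus symbols,
`ϖ⁻·|Ω⁻(V)| = Ω⁻_f`): the odd twin of `GordTwistBaseChangeLowerEvenAt` with `C • V^{(−p)} = W`,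
`V.imaginaryPeriodRat` / `minusPeriod f` and `padicLFunctionMinusBranch`. A predicate on `(W, p)`;
OPEN — NOT in print at any additive pair; its universal closure is NOT asserted.
[cite: BurungaleCastellaSkinner2025, §5 (5.3) and Lemma 5.2.3 (shape only; nothing asserted)]
[cite: SkinnerUrban2014, Cor. 3.6.3 (p. 42) (shape only; nothing asserted)]
[cite: MazurTateTeitelbaum1986Invent, §I.13–I.14 (the minus branch series)] -/
@[conjecture] def GordTwistBaseChangeLowerOddAt (W : WeierstrassCurve ℚ) (p : ℕ) [Fact p.Prime] : Prop :=
  ∀ (V : WeierstrassCurve ℚ) [V.IsElliptic] [V.IsGloballyMinimal] (C : VariableChange ℚ),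
    GoodOrd V p → C • V.quadraticTwist (-(p : ℚ)) = W →
    ∀ {N : ℕ} [NeZero N] (f : CuspForm (Gamma0 N) 2), IsNewformOf V f →
    ∀ (κ : ZpExtension ℚ p) (γ : Field.absoluteGaloisGroup ℚ),
      κ.IsCyclotomic → κ.IsTopGenerator γ → IsCyclotomicVariable p γ →
    ∀ (DV : V.SelmerDualData κ γ) (D : W.SelmerDualData κ γ) (ϖ : ℚ),
      DV.IsTorsion → D.IsTorsion → (ϖ : ℝ) * V.imaginaryPeriodRat = minusPeriod f →
      ∃ (m n : ℕ) (G : IwasawaAlgebra p),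
        iwasawaToPowerSeries p G =
          PowerSeries.C ((p : ℚ_[p]) ^ n) *
            (padicLFunction f (unitRoot V p : ℚ_[p]) *
              (PowerSeries.C ((ϖ : ℚ) : ℚ_[p]) *
                padicLFunctionMinusBranch f (unitRoot V p : ℚ_[p]) (p / 2))) ∧
        ∀ x ∈ DV.charIdeal, ∀ y ∈ D.charIdeal,
          PowerSeries.C ((p : ℤ_[p]) ^ m) * (x * y) ∈ Ideal.span {G}

/-- Unfolding lemma for `GordTwistBaseChangeLowerEvenAt` (to apply the predicate as a function). -/
theorem gordTwistBaseChangeLowerEvenAt_iff (W : WeierstrassCurve ℚ) (p : ℕ) [Fact p.Prime] :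
    GordTwistBaseChangeLowerEvenAt W p ↔
      ∀ (V : WeierstrassCurve ℚ) [V.IsElliptic] [V.IsGloballyMinimal] (C : VariableChange ℚ),
        GoodOrd V p → C • V.quadraticTwist (p : ℚ) = W →
        ∀ {N : ℕ} [NeZero N] (f : CuspForm (Gamma0 N) 2), IsNewformOf V f →
        ∀ (κ : ZpExtension ℚ p) (γ : Field.absoluteGaloisGroup ℚ),
          κ.IsCyclotomic → κ.IsTopGenerator γ → IsCyclotomicVariable p γ →
        ∀ (DV : V.SelmerDualData κ γ) (D : W.SelmerDualData κ γ) (ϖ : ℚ),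
          DV.IsTorsion → D.IsTorsion → (ϖ : ℝ) * V.realPeriodRat = plusPeriod f →
          ∃ (m n : ℕ) (G : IwasawaAlgebra p),
            iwasawaToPowerSeries p G =
              PowerSeries.C ((p : ℚ_[p]) ^ n) *
                (padicLFunction f (unitRoot V p : ℚ_[p]) *
                  (PowerSeries.C ((ϖ : ℚ) : ℚ_[p]) *
                    padicLFunctionBranch f (unitRoot V p : ℚ_[p]) (p / 2))) ∧
            ∀ x ∈ DV.charIdeal, ∀ y ∈ D.charIdeal,
              PowerSeries.C ((p : ℤ_[p]) ^ m) * (x * y) ∈ Ideal.span {G} :=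
  Iff.rfl

/-- Unfolding lemma for `GordTwistBaseChangeLowerOddAt` (to apply the predicate as a function). -/
theorem gordTwistBaseChangeLowerOddAt_iff (W : WeierstrassCurve ℚ) (p : ℕ) [Fact p.Prime] :
    GordTwistBaseChangeLowerOddAt W p ↔
      ∀ (V : WeierstrassCurve ℚ) [V.IsElliptic] [V.IsGloballyMinimal] (C : VariableChange ℚ),
        GoodOrd V p → C • V.quadraticTwist (-(p : ℚ)) = W →
        ∀ {N : ℕ} [NeZero N] (f : CuspForm (Gamma0 N) 2), IsNewformOf V f →
        ∀ (κ : ZpExtension ℚ p) (γ : Field.absoluteGaloisGroup ℚ),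
          κ.IsCyclotomic → κ.IsTopGenerator γ → IsCyclotomicVariable p γ →
        ∀ (DV : V.SelmerDualData κ γ) (D : W.SelmerDualData κ γ) (ϖ : ℚ),
          DV.IsTorsion → D.IsTorsion → (ϖ : ℝ) * V.imaginaryPeriodRat = minusPeriod f →
          ∃ (m n : ℕ) (G : IwasawaAlgebra p),
            iwasawaToPowerSeries p G =
              PowerSeries.C ((p : ℚ_[p]) ^ n) *
                (padicLFunction f (unitRoot V p : ℚ_[p]) *
                  (PowerSeries.C ((ϖ : ℚ) : ℚ_[p]) *
                    padicLFunctionMinusBranch f (unitRoot V p : ℚ_[p]) (p / 2))) ∧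
            ∀ x ∈ DV.charIdeal, ∀ y ∈ D.charIdeal,
              PowerSeries.C ((p : ℤ_[p]) ^ m) * (x * y) ∈ Ideal.span {G} :=
  Iff.rfl

end Summit.BirchSwinnertonDyer.BirchSwinnertonDyer.Theorems.AdditiveBranchIMCTwistField

end
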